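import Literature.Topology.FourManifolds.LeeRasmussen
import Literature.Topology.FourManifolds.DehnSurgery
import Literature.Topology.FourManifolds.SliceRibbon
import Literature.Topology.FourManifolds.ZeroSurgeryHomotopyBallSliceProofs
import Literature.Topology.FourManifolds.ZeroSurgeryHomotopyBallSliceHolds
import Literature.Barriers.SmoothPoincare4.GluckTwistsDissolve
import HarnessLib
import HarnessLib.Audit

/-!
# Crux — zero-surgery pairs with a Rasmussen-invariant witness (two registered OPEN statements)

Topic `Literature/Uncategorized`. This file was CREATED BY THE GATE (accept-time relocation, p72944,
2026-08-16) out of the refuter's Summits proposal `Theorems/ZseCruxRasmussen/Negative/Shape.lean`, which had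
transcribed two ROUTE ITEMS of `Summits/SmoothPoincare4/SmoothPoincare4/Theses/ZeroSurgeryExotic.lean` inline
with `[cite]` tags; the relocation filed them as "named literature facts". They are NOT facts awaiting
discharge. This revision (same declaration names and bodies; only attributes, docstrings and three relating
theorems change) registers them for what they are — OPEN STATEMENTS, exactly like
`Literature.Barriers.SmoothPoincare4.FGMWRasmussenStrategy` / `MMSW2023Question911Knot` of
`Literature/Barriers/SmoothPoincare4/GluckTwistsDissolve.lean`, of which they are the restrictions to homotopy
4-balls born from 0-surgery pairs:

* `Literature.Uncategorized.Crux` (`@[conjecture]`, [status: open]) — route item stmt-SmoothPoincare4-0366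
  (`ZseCruxRasmussen`, crux #2 of route ZeroSurgeryExotic; ledger signature verbatim): there are knots `K, K'`
  with a common `0`-surgery `Y`, `K` smoothly slice and `s(K') ≠ 0`. A proof would DISPROVE `SmoothPoincare4`
  (Manolescu–Piccirillo programme; `fgmwRasmussenStrategy_of_crux` + `FGMWRasmussenStrategy.exists_exotic`).
* `Literature.Uncategorized.SVanishesOnPairs` (`@[conjecture]`, [status: open]) — route item
  stmt-SmoothPoincare4-0368 (kill test, ledger signature verbatim): on such pairs `s(K') = 0`. It is literally
  `¬ Crux` (`not_crux_iff_sVanishesOnPairs`) and follows from MMSW Question 9.11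
  (`sVanishesOnPairs_of_mmsw2023Question911Knot`, via the PROVED Manolescu–Piccirillo Lemma 3.3
  `Knot.ManolescuPiccirillo2023_lemma33_sphere_holds`), hence from `SmoothPoincare4` + Rasmussen's Theorem 1.

Printed status (2026-08): no such pair is known and no vanishing theorem beyond Gluck twists (MMSW Cor. 1.13)
and the (super-)special RBG families (Nakamura 2023 Thm. 3.13; Dunfield–Gong 2025 Thm. 5.9) is in print
[cite: ManolescuPiccirillo2023, §1 p. 1 and Remark 1.5] [cite: ManolescuMarengonSarkarWillis2023, Question 9.11].

LIBRARIAN (D-0022 sweep): suggested home next to `FGMWRasmussenStrategy` in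
`Literature/Barriers/SmoothPoincare4/GluckTwistsDissolve.lean` (or a sibling file), suggested names
`ZeroSurgeryPairRasmussenWitness` (for `Crux`) and `MMSW2023Question911ZeroSurgeryPairs` (for `SVanishesOnPairs`);
the only user is `Summits/SmoothPoincare4/SmoothPoincare4/Theorems/ZseCruxRasmussen/Negative/` (refuter helper
lemmas) and the crux work file `Summits/SmoothPoincare4/SmoothPoincare4/Cruxes/ZseCruxRasmussen/Disproof.lean`.
-/

noncomputable section

namespace Literature.Uncategorized

open scoped Manifold ContDiff
open Literature.Topology.FourManifolds Literature.Barriers.SmoothPoincare4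

/-- OPEN STATEMENT — [status: open]; a registered open existential, NOT a named fact awaiting discharge (it is a
DISPROOF programme for `SmoothPoincare4`). Route item stmt-SmoothPoincare4-0366 (`ZseCruxRasmussen`, crux #2 of
route `SmoothPoincare4/ZeroSurgeryExotic`), ledger signature verbatim: **there are knots `K, K' ⊂ S³` and a
3-manifold `Y` which is `0`-surgery on both (`IsIntegralSurgery (𝓡 3) Y K 0`, `… Y K' 0`), with `K` smoothly
slice and `K'` of non-zero Rasmussen invariant** (`Knot.HasRasmussenInvariant K' s`, `s ≠ 0`). This is the
searchable `s`-witness form of the Manolescu–Piccirillo zero-surgery route to an exotic `S⁴` ("If `K` is slice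
and `S³₀(K) ≅ S³₀(K')` ... `K'` bounds a disk in `W ∖ B̊⁴`. If `s(K') ≠ 0`, then `K'` is not slice and `W` is an
exotic four-sphere"); it implies `FGMWRasmussenStrategy` (`fgmwRasmussenStrategy_of_crux`). No such pair is
known: the five candidates of Manolescu–Piccirillo are not slice (Nakamura 2023, Thm. 1.1) and `s` cannot
detect within the special RBG families (Nakamura 2023, Thm. 3.13; Dunfield–Gong 2025, Thm. 5.9).
[cite: ManolescuPiccirillo2023, §1 p. 1, Thm. 1.3 and Remark 1.5] -/
@[conjecture] def Crux : Prop :=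
  ∃ (K K' : Literature.Topology.FourManifolds.Knot) (Y : Type) (_ : TopologicalSpace Y) (_ : ChartedSpace (EuclideanSpace ℝ (Fin 3)) Y) (s : ℤ), Literature.Topology.FourManifolds.IsIntegralSurgery (𝓡 3) Y K 0 ∧ Literature.Topology.FourManifolds.IsIntegralSurgery (𝓡 3) Y K' 0 ∧ K.IsSmoothlySlice ∧ K'.HasRasmussenInvariant s ∧ s ≠ 0

/-- OPEN STATEMENT — [status: open]; a registered open question, NOT a named fact awaiting discharge. Route item
stmt-SmoothPoincare4-0368 (kill test of crux #2 of route `SmoothPoincare4/ZeroSurgeryExotic`), ledger signature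
verbatim: **if `Y` is `0`-surgery on both `K` and `K'` and `K` is smoothly slice, then every Rasmussen invariant
of `K'` vanishes.** Literally the negation of `Crux` (`not_crux_iff_sVanishesOnPairs`); it is Manolescu–
Marengon–Sarkar–Willis's open Question 9.11 (`MMSW2023Question911Knot`: `s = 0` for knots slice in a homotopy
4-ball) restricted to the homotopy balls born from 0-surgery pairs (`sVanishesOnPairs_of_mmsw2023Question911Knot`,
through the proved Manolescu–Piccirillo Lemma 3.3), so `SmoothPoincare4` together with Rasmussen's Theorem 1
implies it; Kronheimer–Mrowka 2013 Cor. 1.1 had asserted the general statement and withdrew it (corrigendum).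
Known cases in print: Gluck-twist-born balls (MMSW Cor. 1.13), special RBG links (Nakamura 2023 Thm. 3.13),
super-special RBG links (Dunfield–Gong 2025 Thm. 5.9).
[cite: ManolescuMarengonSarkarWillis2023, Question 9.11 and Cor. 1.13] -/
@[conjecture] def SVanishesOnPairs : Prop :=
  ∀ (K K' : Literature.Topology.FourManifolds.Knot) (Y : Type) [TopologicalSpace Y] [ChartedSpace (EuclideanSpace ℝ (Fin 3)) Y] (s : ℤ), Literature.Topology.FourManifolds.IsIntegralSurgery (𝓡 3) Y K 0 → Literature.Topology.FourManifolds.IsIntegralSurgery (𝓡 3) Y K' 0 → K.IsSmoothlySlice → K'.HasRasmussenInvariant s → s = 0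

/-- `SVanishesOnPairs` is literally `¬ Crux` (route items 0368 and 0366 are each other's negation). [folklore] -/
theorem not_crux_iff_sVanishesOnPairs : ¬ Crux ↔ SVanishesOnPairs := by
  constructor
  · intro h K K' Y _ _ s hK hK' hsl hs
    by_contra hs0
    exact h ⟨K, K', Y, _, _, s, hK, hK', hsl, hs, hs0⟩
  · rintro h ⟨K, K', Y, _, _, s, hK, hK', hsl, hs, hs0⟩
    exact hs0 (h K K' Y s hK hK' hsl hs)

/-- **Manolescu–Piccirillo Lemma 3.3 (`W = S⁴`) in `IsIntegralSurgery` form** (PROVED in the tree,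
`Knot.ManolescuPiccirillo2023_lemma33_sphere_holds`, bridged by `FramedLink.isSurgery_single_iff`): if `Y` is
`0`-surgery on `K` and on `K'` and `K` is smoothly slice, then `K'` is slice in a homotopy 4-ball.
[cite: ManolescuPiccirillo2023, Lemma 3.3] -/
theorem isHomotopyBallSlice_of_zeroSurgeryPair {K K' : Knot} {Y : Type} [TopologicalSpace Y]
    [ChartedSpace (EuclideanSpace ℝ (Fin 3)) Y] (hK : IsIntegralSurgery (𝓡 3) Y K 0)
    (hK' : IsIntegralSurgery (𝓡 3) Y K' 0) (hsl : K.IsSmoothlySlice) : K'.IsHomotopyBallSlice :=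
  Knot.ManolescuPiccirillo2023_lemma33_sphere_holds K K' Y
    ((FramedLink.isSurgery_single_iff K 0).2 hK) ((FramedLink.isSurgery_single_iff K' 0).2 hK') hsl

/-- `Crux` is a strengthening of the registered open conjecture `FGMWRasmussenStrategy` (some knot slice in a
homotopy 4-ball has `s ≠ 0`). [cite: FreedmanGompfMorrisonWalker2010, §1] -/
theorem fgmwRasmussenStrategy_of_crux (h : Crux) : FGMWRasmussenStrategy := by
  obtain ⟨K, K', Y, _, _, s, hK, hK', hsl, hs, hs0⟩ := h
  exact ⟨K', isHomotopyBallSlice_of_zeroSurgeryPair hK hK' hsl, s, hs, hs0⟩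

/-- A positive answer to MMSW Question 9.11 (knots) gives `SVanishesOnPairs`, i.e. kills `Crux`.
[cite: ManolescuMarengonSarkarWillis2023, Question 9.11] -/
theorem sVanishesOnPairs_of_mmsw2023Question911Knot (h : MMSW2023Question911Knot) : SVanishesOnPairs :=
  not_crux_iff_sVanishesOnPairs.1 fun hc =>
    (not_fgmwRasmussenStrategy_iff_question.2 h) (fgmwRasmussenStrategy_of_crux hc)

end Literature.Uncategorized

end
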